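/-
Copyright (c) 2026 the pub-hodgecm-mathlib formalisation cell (harness21).  Prover seat hodgecm-mathlib-K2E1-p13 (g6), Track B ∕ K2-LIT, h413 = `stmt-HodgeConjecture-24833`,
R90-TF section S8 «ContSpec-n½», S8 dealer R90-CS-plan (g3) S8-R221 (5) ∕ S8-R222 (b) ruling J-S8-UNF «`K2E1ChiUnfoldingConstantsOfRecordU3` — NAME the unit phases `ε`, the normalising
constant `C > 0` and the bad finset `S₀` of the unfolding (★ (a-2b)) and prove `hε1 hε0 hC`» — the constants OF RECORD that (V) OF RECORD (★ ED. 8 `R90S8ResGMidBlockNeBotOfRecordV8U3`,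
row (iii) binders `ε hε1 hε0 S₀ C hC`) and the `hsrc` supplier head `K2E1ChiMidBlockUnfoldingAtBasePointU3` (R90-CS-p03 (g3), deal (4)) bind BY NAME.
-/
import Summits.HodgeConjecture.HodgeConjecture.Theorems.K2E1ChiIntertwiningScalarEulerProductU3   -- ★ (a-2b) p863248 (R90-CS-p03): `exists_pos_inv_measure_smul_integral_eq_chiEulerProduct_three` (its `∃ C > 0` and its `hgood` bytes)
import Summits.HodgeConjecture.HodgeConjecture.Theorems.K2E1ArchSectionLOnBigCellU3                 -- ★ p863919 (K2E1-p13 (g5)): `archUnitaryValue_neg_conj`, `sub_one_eq_neg_conj` (the `(−1)^m` of the big-cell law)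
import Literature.NumberTheory.GaloisRepresentations.FrobeniusDensityTheorem                    -- ★ `finite_setOf_not_isUnramifiedIn` (only finitely many places of `L⁺` ramify in `L`)
import Literature.NumberTheory.GaloisRepresentations.HeckeCharacterCofiniteProofs               -- ★ `HeckeCharacter.isUnramifiedAt_cofinite_holds`
import Literature.NumberTheory.Rogawski1990.OneDimAutRepH                                        -- ★ `OneDimAutRepH.eψ`, `ψ_arch_apply`, `unit_ψ`
import HarnessLib

/-!
# K2·E1 ∕ R90·S8 — `K2E1ChiUnfoldingConstantsOfRecordU3`: THE CONSTANTS OF RECORD OF THE UNFOLDING — the bad finset `S₀`, the Haar constant `C > 0`, the unit phases `ε_w`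

Cell `pub/hodgecm-mathlib`, crux h413 = `stmt-HodgeConjecture-24833`, route of record `HCCMUnconditional`; R90-TF section S8 «ContSpec-n½», road R2-χ₃ ((V) OF RECORD row (iii): the
amplitude `A z := (C·∏_{v∈S₀} ν_v(𝒪_v³)⁻¹ • ∫ 𝟙_{B_v(𝔫)}·Q_v^{−z}) · ∫_{L_∞}∫_{L⁺_∞} (∏_w ε_w·archUnitaryValue m_w 0 ζ_w·((2+ζ_w)∕ζ_w)^{p_w}·((2+conj ζ_w)∕conj ζ_w)^{q_w})·ARCH₃^{−z}` and
its visible constants `ε hε1 hε0 S₀ C hC`; S8 dealer ruling J-S8-UNF, S8-R222 (b)).  DEFINITIONS + THEOREMS (three `def`s, each the literal object the (V) binder is instantiated with; no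
`instance`, no notation, no named-fact hypothesis, no `sorry`; default heartbeats); lane `--kind definition --supports stmt-HodgeConjecture-24833 --as helper` (count-neutral).  CLOSES NO
SOCKET: it fixes, BY NAME, the three constants the (V)-seam binders `S₀`, `C`, `ε` are instantiated with, and proves the three visible letters `hε1 hε0 hC` about them; the `hsrc` row
itself (the unfolding identity at the moved base point `g₁ = ι_f(w₀^{S₀})`) is R90-CS-p03's supplier head, which imports this file (ruling: «CS-p03 imports p13's constants file, not the reverse»).

THE MATHEMATICS ([MoeglinWaldspurger1995] II.1.6–II.1.7, IV.1.11; [Rogawski1990] §13.9 p. 229; [TateThesis1967] Thm 3.3.1; [Patrikis2019] §2.1).  The intertwining scalar of the mid-block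
witness unfolds (★ (a-2b)) as `q(z) = C·(∫∫ A_∞)·(∏_{v∈S₀} m_v(z))·c_χ^S(z)` on `2 < Re z`, for ONE Haar constant `C > 0` and EVERY finset `S₀` off which all places are good (`hgood`: `v` unramified
in `L∕L⁺`, `|2|_v = 1`, `δ` a unit above `v`, the character unramified above `v`).
* §1 **`S₀` OF RECORD** (ruling J-S8-UNF: «places under supp `𝔫` ∪ {v ∣ 2} ∪ {δ non-unit} ∪ {ramified}»): `unfoldingBadPlaces hδ h𝔫` — a `Finset` by the ★ cofinite suppliers
  (`finite_setOf_not_isUnramifiedIn`, `eventually_valued_algebraMap_eq_one`, `eventually_forall_placesOver`) and Mathlib `Ideal.finite_factors`; `good_of_not_mem_unfoldingBadPlaces` (the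
  four clauses off `S₀`), `under_mem_unfoldingBadPlaces_of_dvd`, and **`hgood_unfoldingBadPlaces`** = ★ (a-2b)'s `hgood` BYTES for every Hecke character `φ` whose ramification divides `𝔫`.
* §2 **`C` OF RECORD**: `unfoldingHaarConst …` := THE `∃ C > 0` of ★ (a-2b), chosen once (`Classical.choose`); `unfoldingHaarConst_pos`, **`ofReal_unfoldingHaarConst_ne_zero`** (= (V)'s `hC`
  at `C := ↑(unfoldingHaarConst …)`), **`unfoldingHaarConst_spec`** (★ (a-2b)'s `∀`-body VERBATIM at the named constant — consumers never re-`obtain`).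
* §3 **`ε` OF RECORD, PER PLACE** (no distinguished place): `unfoldingArchPhase ξ w := (−1)^{eψ_w}` — the value at `−1` of the archimedean component `u ↦ u^{−eψ_w}` of `ξ.ψ` (★
  `OneDimAutRepH.ψ_arch_apply`), i.e. the `w`-factor of `ξ.ψ⟨det ι_∞(ι(w₀)·u)⟩ = ξ.ψ(−1_∞, 1_f)` (`det (Φ₃·u) = −1`, ★ `det_weylLong_mul_heis`); `norm_unfoldingArchPhase` (`= 1`),
  **`unfoldingArchPhase_norm_le_one`** (`hε1`), **`unfoldingArchPhase_ne_zero`** (`hε0`), `infiniteIdeles_neg_one_mem_torus`, and THE TORUS VALUE **`ψ_neg_one_arch_eq_prod_unfoldingArchPhase`**: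
  `ξ.ψ(−1_∞, 1_f) = ∏_w unfoldingArchPhase ξ w`.
* §4 **THE `(−1)^{m_w}` OF ★ p13's BIG-CELL LAW CANCELS**: `(−1)^m · conj (archUnitaryValue m 0 (1 − conj Z)) = archUnitaryValue m 0 (Z − 1)` (★ `archUnitaryValue_neg_conj` at `t = 0`), so NO
  `m_w`-dependent sign is carried by `ε`.
* SEQUEL (file (5b) `K2E1ChiUnfoldingArchPhaseOfRecordU3`, theorems only): ★ p864477's shifted big-cell law rewritten in (V)'s letters `ζ_w := −(1 + ‖X_w‖²∕2) + (Im φ_w(δ)·s_w(t))·I`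
  with §4's cancellation, and the torus element `⟨det ι_∞((ι(w₀)·u)_∞)⟩ = (−1_∞, 1_f)`, so that `Φ^{p,q}(a) = ∏_w ε_w·archUnitaryValue m_w 0 ζ_w·((2+ζ_w)∕ζ_w)^{p_w}·((2+conj ζ_w)∕conj ζ_w)^{q_w}` —
  the (V) integrand phase for phase, nothing archimedean carried in `C`.
HONEST SCOPE.  NOT here: the identification of the torus element `⟨det ι_∞((ι(w₀)·u)_∞)⟩` with `(−1_∞, 1_f)` and the (V)-shape rewrite (file (5b)), the level `𝔫` of
record (★ p864411 `exists_levelOfRecord_dvd`, any `𝔫 ≠ 0` divisible by the bad places), and the `hsrc` row (R90-CS-p03's head over ★ (a-2b) + the pure-tensor reading of the finite witness).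
HONEST LABEL: HC_CM is proved only modulo the 7 printed citations (2 remaining named inputs: hLiu418 = `stmt-HodgeConjecture-24832`, h413 = `stmt-HodgeConjecture-24833`) until rung 0
closes; REL ≠ ★ ≠ BUILT; naming pays no socket; this file asserts no named fact; count-neutral.

## References
* [MoeglinWaldspurger1995] C. Mœglin, J.-L. Waldspurger, *Spectral Decomposition and Eisenstein Series* (1995): II.1.6–II.1.7, IV.1.11.
* [Rogawski1990] J. D. Rogawski, *Automorphic Representations of Unitary Groups in Three Variables*, Ann. of Math. Stud. 123 (1990): §1.10 p. 9, §12.2 p. 174, §13.9 p. 229.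
* [TateThesis1967] J. Tate, *Fourier analysis in number fields and Hecke's zeta-functions* (1967): Lemma 3.2.1, Thm 3.3.1.
* [Patrikis2019] S. Patrikis, *Variations on a theorem of Tate*, Mem. AMS 258 (2019): §2.1.
* [BorelJacquet1979] A. Borel, H. Jacquet, *Automorphic forms and automorphic representations*, Corvallis PSPM 33.1 (1979): §4.1.
-/

set_option autoImplicit false
set_option linter.dupNamespace false -- the mandated namespace repeats `HodgeConjecture.HodgeConjecture`

noncomputable section

open MeasureTheory MeasureTheory.Measure NumberField NumberField.InfinitePlace IsDedekindDomain Filter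
open scoped NNReal ENNReal Classical ComplexConjugate
open Literature.NumberTheory.Automorphic Literature.NumberTheory.Automorphic.UnitaryGroup Literature.NumberTheory.GaloisRepresentations
open Literature.NumberTheory.GaloisRepresentations.IsNonarchimedeanLocalField Literature.NumberTheory.LFunctions AdelicGroupData
open Literature.NumberTheory.Automorphic.Arthur2013.Leaves.TECR
open Literature.NumberTheory.Automorphic.UnitaryGroup.AdelicCharactersDetQuasiSplit (antidiagonal_over_det_ne_zero)
open Literature.NumberTheory.Rogawski1990 (OneDimAutRepH)
open Summit.HodgeConjecture.HodgeConjecture.Cruxes.H413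
open Summit.HodgeConjecture.HodgeConjecture.Cruxes.H413.K2E1ChiIntertwiningScalarEulerProductU3 (exists_pos_inv_measure_smul_integral_eq_chiEulerProduct_three)
open Summit.HodgeConjecture.HodgeConjecture.Cruxes.H413.K2E1ArchSectionLOnBigCellU3 (archUnitaryValue_neg_conj sub_one_eq_neg_conj)

namespace Summit.HodgeConjecture.HodgeConjecture.Cruxes.H413.K2E1ChiUnfoldingConstantsOfRecordU3

variable (L : Type) [Field L] [NumberField L]

/-! ## §1 `S₀` OF RECORD: places under `supp 𝔫` ∪ {`v ∣ 2`} ∪ {`δ` not a unit above `v`} ∪ {`v` ramified in `L∕L⁺`} -/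

section BadPlaces

variable {δ : L} (hδ : δ ≠ 0) {𝔫 : Ideal (𝓞 L)} (h𝔫 : 𝔫 ≠ 0)

include hδ h𝔫 in
/-- The set of bad places of `L⁺` is finite: off a finite set every place `v` is unramified in `L`, prime to `2`, `δ` is a unit at every `w' ∣ v`, and no `w' ∣ v` divides `𝔫` (★ cofinite
suppliers `finite_setOf_not_isUnramifiedIn`, `eventually_valued_algebraMap_eq_one`, `eventually_forall_placesOver`; Mathlib `Ideal.finite_factors`). [cite: TateThesis1967, Lemma 3.2.1] -/
theorem finite_badPlaces :
    {v : HeightOneSpectrum (𝓞 ↥(maximalRealSubfield L)) | ¬ ((Algebra.IsUnramifiedIn (𝓞 L) v.asIdeal ∧ Valued.v (2 : v.adicCompletion ↥(maximalRealSubfield L)) = 1 ∧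
        ∀ w : PlacesOver L v, Valued.v (algebraMap L (LocalRing L v) δ w) = 1) ∧ ∀ w : PlacesOver L v, ¬ w.1.asIdeal ∣ 𝔫)}.Finite := by
  have e1 : ∀ᶠ v : HeightOneSpectrum (𝓞 ↥(maximalRealSubfield L)) in cofinite, Algebra.IsUnramifiedIn (𝓞 L) v.asIdeal :=
    Filter.eventually_cofinite.2 (Literature.NumberTheory.GaloisRepresentations.finite_setOf_not_isUnramifiedIn ↥(maximalRealSubfield L) L)
  have e2 : ∀ᶠ v : HeightOneSpectrum (𝓞 ↥(maximalRealSubfield L)) in cofinite, Valued.v (2 : v.adicCompletion ↥(maximalRealSubfield L)) = 1 := by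
    filter_upwards [eventually_valued_algebraMap_eq_one (E := ↥(maximalRealSubfield L)) (two_ne_zero : (2 : ↥(maximalRealSubfield L)) ≠ 0)] with v hv
    rwa [map_ofNat] at hv
  have e3 : ∀ᶠ v : HeightOneSpectrum (𝓞 ↥(maximalRealSubfield L)) in cofinite, ∀ w : PlacesOver L v, Valued.v (algebraMap L (LocalRing L v) δ w) = 1 :=
    eventually_forall_placesOver (F := ↥(maximalRealSubfield L)) (E := L) (eventually_valued_algebraMap_eq_one (E := L) hδ)
  have e4 : ∀ᶠ v : HeightOneSpectrum (𝓞 ↥(maximalRealSubfield L)) in cofinite, ∀ w : PlacesOver L v, ¬ w.1.asIdeal ∣ 𝔫 := by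
    refine eventually_forall_placesOver (F := ↥(maximalRealSubfield L)) (E := L) (Q := fun w => ¬ w.asIdeal ∣ 𝔫) ?_
    rw [Filter.eventually_cofinite]
    simp only [not_not]
    exact Ideal.finite_factors h𝔫
  have e := (e1.and (e2.and e3)).and e4
  rwa [Filter.eventually_cofinite] at e

/-- **`S₀` OF RECORD — `unfoldingBadPlaces hδ h𝔫`**: the finite set of finite places `v` of `L⁺` that are ramified in `L`, or divide `2`, or above which `δ` is not a unit, or above which some
place of `L` divides the level `𝔫` (S8 dealer ruling J-S8-UNF: «places under supp `𝔫` ∪ {`v ∣ 2`} ∪ {`δ` non-unit} ∪ {ramified}»).  Off `S₀` every place is GOOD for the unfolding ★ (a-2b)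
(`hgood_unfoldingBadPlaces`) and the moved base point `ι_f(w₀^{S₀})` sees the 𝔫-balls. [cite: MoeglinWaldspurger1995, II.1.7] [cite: TateThesis1967, Thm 3.3.1] -/
def unfoldingBadPlaces : Finset (HeightOneSpectrum (𝓞 ↥(maximalRealSubfield L))) :=
  (finite_badPlaces L hδ h𝔫).toFinset

/-- Membership read-back: `v ∈ S₀ ↔ v` is bad. [cite: TateThesis1967, Lemma 3.2.1] -/
theorem mem_unfoldingBadPlaces_iff (v : HeightOneSpectrum (𝓞 ↥(maximalRealSubfield L))) :
    v ∈ unfoldingBadPlaces L hδ h𝔫 ↔ ¬ ((Algebra.IsUnramifiedIn (𝓞 L) v.asIdeal ∧ Valued.v (2 : v.adicCompletion ↥(maximalRealSubfield L)) = 1 ∧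
        ∀ w : PlacesOver L v, Valued.v (algebraMap L (LocalRing L v) δ w) = 1) ∧ ∀ w : PlacesOver L v, ¬ w.1.asIdeal ∣ 𝔫) := by
  simp only [unfoldingBadPlaces, Set.Finite.mem_toFinset, Set.mem_setOf_eq]

/-- **OFF `S₀` EVERY PLACE IS GOOD**: `v ∉ S₀ ⇒` (`v` unramified in `L`, `|2|_v = 1`, `δ` a unit at every `w' ∣ v`) and no `w' ∣ v` divides `𝔫`. [cite: TateThesis1967, Thm 3.3.1] -/
theorem good_of_not_mem_unfoldingBadPlaces {v : HeightOneSpectrum (𝓞 ↥(maximalRealSubfield L))} (hv : v ∉ unfoldingBadPlaces L hδ h𝔫) :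
    (Algebra.IsUnramifiedIn (𝓞 L) v.asIdeal ∧ Valued.v (2 : v.adicCompletion ↥(maximalRealSubfield L)) = 1 ∧
        ∀ w : PlacesOver L v, Valued.v (algebraMap L (LocalRing L v) δ w) = 1) ∧ ∀ w : PlacesOver L v, ¬ w.1.asIdeal ∣ 𝔫 := by
  by_contra h
  exact hv ((mem_unfoldingBadPlaces_iff L hδ h𝔫 v).2 h)

/-- **Every place of `L` dividing `𝔫` lies over `S₀`**: `w.asIdeal ∣ 𝔫 ⇒ w ∩ 𝓞_{L⁺} ∈ S₀`. [cite: MoeglinWaldspurger1995, II.1.7] -/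
theorem under_mem_unfoldingBadPlaces_of_dvd (w : HeightOneSpectrum (𝓞 L)) (hw : w.asIdeal ∣ 𝔫) :
    w.under (𝓞 ↥(maximalRealSubfield L)) ∈ unfoldingBadPlaces L hδ h𝔫 := by
  by_contra hv
  exact (good_of_not_mem_unfoldingBadPlaces L hδ h𝔫 hv).2 ⟨w, rfl⟩ hw

/-- The same for a place presented over `v`: `w' ∣ v`, `w'.asIdeal ∣ 𝔫 ⇒ v ∈ S₀`. [cite: MoeglinWaldspurger1995, II.1.7] -/
theorem mem_unfoldingBadPlaces_of_dvd {v : HeightOneSpectrum (𝓞 ↥(maximalRealSubfield L))} (w : PlacesOver L v) (hw : w.1.asIdeal ∣ 𝔫) :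
    v ∈ unfoldingBadPlaces L hδ h𝔫 := by
  by_contra hv
  exact (good_of_not_mem_unfoldingBadPlaces L hδ h𝔫 hv).2 w hw

/-- The places above `2`, the places where `δ` is not a unit and the ramified places are in `S₀` (contrapositive read-backs). [cite: TateThesis1967, Lemma 3.2.1] -/
theorem mem_unfoldingBadPlaces_of_not_isUnramifiedIn {v : HeightOneSpectrum (𝓞 ↥(maximalRealSubfield L))} (hv : ¬ Algebra.IsUnramifiedIn (𝓞 L) v.asIdeal) :
    v ∈ unfoldingBadPlaces L hδ h𝔫 := by
  by_contra h
  exact hv (good_of_not_mem_unfoldingBadPlaces L hδ h𝔫 h).1.1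

/-- **★ (a-2b)'s LETTER `hgood` AT `S₀` OF RECORD**, for every Hecke character `φ` of `L` whose ramified places divide the level `𝔫` (the level of record is a conductor level, ★ p864411):
`∀ v ∉ S₀, (v unramified in L ∧ |2|_v = 1 ∧ ∀ w' ∣ v, |δ|_{w'} = 1) ∧ ∀ w' ∣ v, φ unramified at w'` — ★ `exists_pos_inv_measure_smul_integral_eq_chiEulerProduct_three`'s `hgood` binder BYTE FOR BYTE.
[cite: TateThesis1967, Thm 3.3.1] [cite: MoeglinWaldspurger1995, II.1.7] -/
theorem hgood_unfoldingBadPlaces (φ : HeckeCharacter L) (hφ𝔫 : ∀ w : HeightOneSpectrum (𝓞 L), ¬ φ.IsUnramifiedAt w → w.asIdeal ∣ 𝔫) :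
    ∀ v ∉ unfoldingBadPlaces L hδ h𝔫, (Algebra.IsUnramifiedIn (𝓞 L) v.asIdeal ∧ Valued.v (2 : v.adicCompletion ↥(maximalRealSubfield L)) = 1 ∧
        ∀ w : PlacesOver L v, Valued.v (algebraMap L (LocalRing L v) δ w) = 1) ∧ ∀ w : PlacesOver L v, φ.IsUnramifiedAt w.1 := by
  intro v hv
  have h := good_of_not_mem_unfoldingBadPlaces L hδ h𝔫 hv
  refine ⟨h.1, fun w => ?_⟩
  by_contra hur
  exact h.2 w (hφ𝔫 w.1 hur)

/-- **Any finset containing `S₀` is still good** (★ (a-2b) quantifies over all good finsets). [cite: TateThesis1967, Thm 3.3.1] -/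
theorem hgood_of_unfoldingBadPlaces_subset (φ : HeckeCharacter L) (hφ𝔫 : ∀ w : HeightOneSpectrum (𝓞 L), ¬ φ.IsUnramifiedAt w → w.asIdeal ∣ 𝔫)
    {S₀ : Finset (HeightOneSpectrum (𝓞 ↥(maximalRealSubfield L)))} (hS₀ : unfoldingBadPlaces L hδ h𝔫 ⊆ S₀) :
    ∀ v ∉ S₀, (Algebra.IsUnramifiedIn (𝓞 L) v.asIdeal ∧ Valued.v (2 : v.adicCompletion ↥(maximalRealSubfield L)) = 1 ∧
        ∀ w : PlacesOver L v, Valued.v (algebraMap L (LocalRing L v) δ w) = 1) ∧ ∀ w : PlacesOver L v, φ.IsUnramifiedAt w.1 :=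
  fun v hv => hgood_unfoldingBadPlaces L hδ h𝔫 φ hφ𝔫 v fun h => hv (hS₀ h)

end BadPlaces

/-! ## §2 `C` OF RECORD: the Haar constant of ★ (a-2b), chosen once -/

section HaarConst

variable [IsCMField L] (hc : IsCMField.complexConj L * IsCMField.complexConj L = 1) {δ : L} (hcδ : IsCMField.complexConj L δ = -δ) (hδ : δ ≠ 0)
  {d : ↥(maximalRealSubfield L)} (hd : δ * δ = algebraMap ↥(maximalRealSubfield L) L d)
  [MeasurableSpace ↥(adelicUnipotent ↥(maximalRealSubfield L) L (IsCMField.complexConj L) 3)] [BorelSpace ↥(adelicUnipotent ↥(maximalRealSubfield L) L (IsCMField.complexConj L) 3)]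
  [MeasurableSpace (AdeleRing (𝓞 L) L)] [BorelSpace (AdeleRing (𝓞 L) L)]
  [MeasurableSpace (AdeleRing (𝓞 ↥(maximalRealSubfield L)) ↥(maximalRealSubfield L))] [BorelSpace (AdeleRing (𝓞 ↥(maximalRealSubfield L)) ↥(maximalRealSubfield L))]
  [MeasurableSpace (InfiniteAdeleRing L)] [BorelSpace (InfiniteAdeleRing L)]
  [MeasurableSpace (InfiniteAdeleRing ↥(maximalRealSubfield L))] [BorelSpace (InfiniteAdeleRing ↥(maximalRealSubfield L))]
  [MeasurableSpace (FiniteAdeleRing (𝓞 L) L)] [BorelSpace (FiniteAdeleRing (𝓞 L) L)]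
  [MeasurableSpace (FiniteAdeleRing (𝓞 ↥(maximalRealSubfield L)) ↥(maximalRealSubfield L))] [BorelSpace (FiniteAdeleRing (𝓞 ↥(maximalRealSubfield L)) ↥(maximalRealSubfield L))]
  [∀ v : HeightOneSpectrum (𝓞 ↥(maximalRealSubfield L)), MeasurableSpace (v.adicCompletion ↥(maximalRealSubfield L))] [∀ v : HeightOneSpectrum (𝓞 ↥(maximalRealSubfield L)), BorelSpace (v.adicCompletion ↥(maximalRealSubfield L))]
  (ν : Measure ↥(adelicUnipotent ↥(maximalRealSubfield L) L (IsCMField.complexConj L) 3)) [ν.IsHaarMeasure]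
  {𝓕 : Set ↥(adelicUnipotent ↥(maximalRealSubfield L) L (IsCMField.complexConj L) 3)} (h𝓕 : IsFundamentalDomain ↥(rationalUnipotent ↥(maximalRealSubfield L) L (IsCMField.complexConj L) 3) 𝓕 ν)
  (μE : Measure (AdeleRing (𝓞 L) L)) [μE.IsAddHaarMeasure] (μE₁ : Measure (InfiniteAdeleRing L)) [μE₁.IsAddHaarMeasure]
  (μE₂ : Measure (FiniteAdeleRing (𝓞 L) L)) [μE₂.IsAddHaarMeasure]
  (μF : Measure (AdeleRing (𝓞 ↥(maximalRealSubfield L)) ↥(maximalRealSubfield L))) [μF.IsAddHaarMeasure] (μF₁ : Measure (InfiniteAdeleRing ↥(maximalRealSubfield L))) [μF₁.IsAddHaarMeasure]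
  (μF₂ : Measure (FiniteAdeleRing (𝓞 ↥(maximalRealSubfield L)) ↥(maximalRealSubfield L))) [μF₂.IsAddHaarMeasure]
  (νv : ∀ v : HeightOneSpectrum (𝓞 ↥(maximalRealSubfield L)), Measure (v.adicCompletion ↥(maximalRealSubfield L))) [∀ v, (νv v).IsAddHaarMeasure]
  {φ : HeckeCharacter L} {ψ : HeckeCharacter ↥(maximalRealSubfield L)} (hφ : φ.IsUnitary) (hψ : (ψ * quadraticHeckeCharCM L).IsUnitary)
  (hres : ∀ x, φ (AdeleRing.ideleBaseChange ↥(maximalRealSubfield L) L x) = ψ x)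

/-- **`C` OF RECORD — `unfoldingHaarConst …`**: THE Haar constant `C > 0` of ★ (a-2b) `exists_pos_inv_measure_smul_integral_eq_chiEulerProduct_three` (a product of Haar normalisations of
`ν, μ_E, μ_{E,∞}, μ_{E,f}, μ_F, μ_{F,∞}, μ_{F,f}, ν_v` — the same for every bad finset, every `z`, every factorised integrand), CHOSEN ONCE so that every consumer of the unfolding names the
same number.  (V) OF RECORD instantiates its binder `C : ℂ` with `↑(unfoldingHaarConst …)`. [cite: MoeglinWaldspurger1995, II.1.7, IV.1.11] [cite: TateThesis1967, Thm 3.3.1] -/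
def unfoldingHaarConst : ℝ :=
  Classical.choose (exists_pos_inv_measure_smul_integral_eq_chiEulerProduct_three L hc hcδ hδ hd ν h𝓕 μE μE₁ μE₂ μF μF₁ μF₂ νv hφ hψ hres)

/-- **`0 < C`**. [cite: MoeglinWaldspurger1995, II.1.7] -/
theorem unfoldingHaarConst_pos : 0 < unfoldingHaarConst L hc hcδ hδ hd ν h𝓕 μE μE₁ μE₂ μF μF₁ μF₂ νv hφ hψ hres :=
  (Classical.choose_spec (exists_pos_inv_measure_smul_integral_eq_chiEulerProduct_three L hc hcδ hδ hd ν h𝓕 μE μE₁ μE₂ μF μF₁ μF₂ νv hφ hψ hres)).1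

/-- `C ≠ 0` (real form). [cite: MoeglinWaldspurger1995, II.1.7] -/
theorem unfoldingHaarConst_ne_zero : unfoldingHaarConst L hc hcδ hδ hd ν h𝓕 μE μE₁ μE₂ μF μF₁ μF₂ νv hφ hψ hres ≠ 0 :=
  (unfoldingHaarConst_pos L hc hcδ hδ hd ν h𝓕 μE μE₁ μE₂ μF μF₁ μF₂ νv hφ hψ hres).ne'

/-- **`(C : ℂ) ≠ 0`** — (V) OF RECORD's visible letter `hC` at `C := ↑(unfoldingHaarConst …)`. [cite: MoeglinWaldspurger1995, II.1.7] -/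
theorem ofReal_unfoldingHaarConst_ne_zero : ((unfoldingHaarConst L hc hcδ hδ hd ν h𝓕 μE μE₁ μE₂ μF μF₁ μF₂ νv hφ hψ hres : ℝ) : ℂ) ≠ 0 :=
  Complex.ofReal_ne_zero.2 (unfoldingHaarConst_ne_zero L hc hcδ hδ hd ν h𝓕 μE μE₁ μE₂ μF μF₁ μF₂ νv hφ hψ hres)

/-- `0 < ‖(C : ℂ)‖ = C`. [cite: MoeglinWaldspurger1995, II.1.7] -/
theorem norm_ofReal_unfoldingHaarConst : ‖((unfoldingHaarConst L hc hcδ hδ hd ν h𝓕 μE μE₁ μE₂ μF μF₁ μF₂ νv hφ hψ hres : ℝ) : ℂ)‖ =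
    unfoldingHaarConst L hc hcδ hδ hd ν h𝓕 μE μE₁ μE₂ μF μF₁ μF₂ νv hφ hψ hres := by
  rw [Complex.norm_real, Real.norm_of_nonneg (unfoldingHaarConst_pos L hc hcδ hδ hd ν h𝓕 μE μE₁ μE₂ μF μF₁ μF₂ νv hφ hψ hres).le]

/-- **THE UNFOLDING AT THE NAMED CONSTANT** — ★ (a-2b)'s `∀`-body VERBATIM with `C := unfoldingHaarConst …`: for every bad finset `S₀` (`hgood`), every `z` with `2 < Re z`, every local weight family
`ω` (`hωc hω1`), archimedean factor `A_∞`, pure-tensor finite weight `Ω` (`hΩ`), every `ν`-integrable `T` factorised on the big cell (`hfac`), with `hfin` and the tokens `hin hsp`: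
`(ν𝓕)⁻¹ • ∫_{N(𝔸)} T dν = C · (∫_{L_∞}∫_{L⁺_∞} A_∞) · ((∏_{v∈S₀} m_v(z)) · c_χ^S(z))`. [cite: MoeglinWaldspurger1995, II.1.7, IV.1.11] [cite: TateThesis1967, Thm 3.3.1] [cite: Rogawski1990, §13.9 p. 229] -/
theorem unfoldingHaarConst_spec (S₀ : Finset (HeightOneSpectrum (𝓞 ↥(maximalRealSubfield L))))
    (hgood : ∀ v ∉ S₀, (Algebra.IsUnramifiedIn (𝓞 L) v.asIdeal ∧ Valued.v (2 : v.adicCompletion ↥(maximalRealSubfield L)) = 1 ∧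
      ∀ w : PlacesOver L v, Valued.v (algebraMap L (LocalRing L v) δ w) = 1) ∧ ∀ w : PlacesOver L v, φ.IsUnramifiedAt w.1)
    {z : ℂ} (hz : 2 < z.re)
    (ω : ∀ v : HeightOneSpectrum (𝓞 ↥(maximalRealSubfield L)), (Fin 3 → v.adicCompletion ↥(maximalRealSubfield L)) → ℂ)
    (hωc : ∀ v, Continuous fun p : Fin 3 → v.adicCompletion ↥(maximalRealSubfield L) =>
      ω v p * (((∏ w' : PlacesOver L v, max 1 (max ((normAbs (w'.1.adicCompletion L) (quadraticLocalEquiv L v (IsCMField.complexConj L) hcδ hδ (p 0, p 1) w') : ℝ≥0) : ℝ)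
          ((normAbs (w'.1.adicCompletion L) ((toLocalRing L v (p 2) * algebraMap L (LocalRing L v) δ -
            toLocalRing L v 2⁻¹ * (quadraticLocalEquiv L v (IsCMField.complexConj L) hcδ hδ (p 0, p 1) *
              conjLocal L (IsCMField.complexConj L) v (quadraticLocalEquiv L v (IsCMField.complexConj L) hcδ hδ (p 0, p 1)))) w') : ℝ≥0) : ℝ))) : ℝ) : ℂ) ^ (-z))
    (hω1 : ∀ v ∉ S₀, ∀ p ∈ integralBox ↥(maximalRealSubfield L) (Fin 3) v, ω v p = 1)
    (Ainf : InfiniteAdeleRing L → InfiniteAdeleRing ↥(maximalRealSubfield L) → ℂ)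
    (Ω : FiniteAdeleRing (𝓞 L) L → FiniteAdeleRing (𝓞 ↥(maximalRealSubfield L)) ↥(maximalRealSubfield L) → ℂ)
    (hΩ : ∀ x : Fin 3 → FiniteAdeleRing (𝓞 ↥(maximalRealSubfield L)) ↥(maximalRealSubfield L),
      Ω (quadraticFiniteAdeleMap ↥(maximalRealSubfield L) L δ (x 0, x 1)) (x 2) = ∏ᶠ v : HeightOneSpectrum (𝓞 ↥(maximalRealSubfield L)), ω v (fun i => x i v))
    (T : ↥(adelicUnipotent ↥(maximalRealSubfield L) L (IsCMField.complexConj L) 3) → ℂ) (hT : Integrable T ν)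
    (hfac : ∀ (X : AdeleRing (𝓞 L) L) (s : AdeleRing (𝓞 ↥(maximalRealSubfield L)) ↥(maximalRealSubfield L)),
      T (heisChart hc (X, traceZeroLine ↥(maximalRealSubfield L) L (IsCMField.complexConj L) hcδ hδ s)) =
        Ainf (X.1) (s.1) * (Ω (X.2) (s.2) * ((((∏ᶠ w : HeightOneSpectrum (𝓞 L), max 1 (max ‖((X) : AdeleRing (𝓞 L) L).2 w‖₊ ‖(heisZ (c := IsCMField.complexConj L) ((X) : AdeleRing (𝓞 L) L) ((traceZeroLine ↥(maximalRealSubfield L) L (IsCMField.complexConj L) hcδ hδ ((0, s.2) : AdeleRing (𝓞 ↥(maximalRealSubfield L)) ↥(maximalRealSubfield L)) : traceZeroAdele ↥(maximalRealSubfield L) L (IsCMField.complexConj L)) : AdeleRing (𝓞 L) L)).2 w‖₊) : ℝ≥0) : ℝ) : ℂ) ^ (-z))))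
    (hfin : Integrable (fun q : FiniteAdeleRing (𝓞 L) L × FiniteAdeleRing (𝓞 ↥(maximalRealSubfield L)) ↥(maximalRealSubfield L) =>
      (Ω (q.1) (q.2) * ((((∏ᶠ w : HeightOneSpectrum (𝓞 L), max 1 (max ‖((((0 : InfiniteAdeleRing L)), q.1) : AdeleRing (𝓞 L) L).2 w‖₊ ‖(heisZ (c := IsCMField.complexConj L) ((((0 : InfiniteAdeleRing L)), q.1) : AdeleRing (𝓞 L) L) ((traceZeroLine ↥(maximalRealSubfield L) L (IsCMField.complexConj L) hcδ hδ ((0, q.2) : AdeleRing (𝓞 ↥(maximalRealSubfield L)) ↥(maximalRealSubfield L)) : traceZeroAdele ↥(maximalRealSubfield L) L (IsCMField.complexConj L)) : AdeleRing (𝓞 L) L)).2 w‖₊) : ℝ≥0) : ℝ) : ℂ) ^ (-z)))) (μE₂.prod μF₂))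
    (hin : ∀ v ∉ S₀, ∀ w : PlacesOver L v, IsCMField.complexConj L • w.1 = w.1 →
      ((Measure.pi fun _ : Fin 3 => νv v) (integralBox ↥(maximalRealSubfield L) (Fin 3) v)).toReal⁻¹ •
          ∫ p : Fin 3 → v.adicCompletion ↥(maximalRealSubfield L),
            ω v p * (((∏ w' : PlacesOver L v, max 1 (max ((normAbs (w'.1.adicCompletion L) (quadraticLocalEquiv L v (IsCMField.complexConj L) hcδ hδ (p 0, p 1) w') : ℝ≥0) : ℝ)
              ((normAbs (w'.1.adicCompletion L) ((toLocalRing L v (p 2) * algebraMap L (LocalRing L v) δ -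
                toLocalRing L v 2⁻¹ * (quadraticLocalEquiv L v (IsCMField.complexConj L) hcδ hδ (p 0, p 1) *
                  conjLocal L (IsCMField.complexConj L) v (quadraticLocalEquiv L v (IsCMField.complexConj L) hcδ hδ (p 0, p 1)))) w') : ℝ≥0) : ℝ))) : ℝ) : ℂ) ^ (-z)
            ∂(Measure.pi fun _ : Fin 3 => νv v) =
        (1 - φ.valueAtUniformizer w.1 * (v.residueCard : ℂ) ^ (-(2 * z))) * (1 + φ.valueAtUniformizer w.1 * (v.residueCard : ℂ) ^ (-(2 * z - 1))) /
          ((1 - φ.valueAtUniformizer w.1 * (v.residueCard : ℂ) ^ (-(2 * z - 2))) * (1 + φ.valueAtUniformizer w.1 * (v.residueCard : ℂ) ^ (-(2 * z - 2)))))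
    (hsp : ∀ v ∉ S₀, ∀ w : PlacesOver L v, IsCMField.complexConj L • w.1 ≠ w.1 →
      ((Measure.pi fun _ : Fin 3 => νv v) (integralBox ↥(maximalRealSubfield L) (Fin 3) v)).toReal⁻¹ •
          ∫ p : Fin 3 → v.adicCompletion ↥(maximalRealSubfield L),
            ω v p * (((∏ w' : PlacesOver L v, max 1 (max ((normAbs (w'.1.adicCompletion L) (quadraticLocalEquiv L v (IsCMField.complexConj L) hcδ hδ (p 0, p 1) w') : ℝ≥0) : ℝ)
              ((normAbs (w'.1.adicCompletion L) ((toLocalRing L v (p 2) * algebraMap L (LocalRing L v) δ -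
                toLocalRing L v 2⁻¹ * (quadraticLocalEquiv L v (IsCMField.complexConj L) hcδ hδ (p 0, p 1) *
                  conjLocal L (IsCMField.complexConj L) v (quadraticLocalEquiv L v (IsCMField.complexConj L) hcδ hδ (p 0, p 1)))) w') : ℝ≥0) : ℝ))) : ℝ) : ℂ) ^ (-z)
            ∂(Measure.pi fun _ : Fin 3 => νv v) =
        (1 - φ.valueAtUniformizer w.1 * (v.residueCard : ℂ) ^ (-z)) * (1 - φ.valueAtUniformizer (PlacesOver.galInv (IsCMField.complexConj L) w).1 * (v.residueCard : ℂ) ^ (-z)) *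
            (1 - φ.valueAtUniformizer w.1 * φ.valueAtUniformizer (PlacesOver.galInv (IsCMField.complexConj L) w).1 * (v.residueCard : ℂ) ^ (-(2 * z - 1))) /
          ((1 - φ.valueAtUniformizer w.1 * (v.residueCard : ℂ) ^ (-(z - 1))) * (1 - φ.valueAtUniformizer (PlacesOver.galInv (IsCMField.complexConj L) w).1 * (v.residueCard : ℂ) ^ (-(z - 1))) *
            (1 - φ.valueAtUniformizer w.1 * φ.valueAtUniformizer (PlacesOver.galInv (IsCMField.complexConj L) w).1 * (v.residueCard : ℂ) ^ (-(2 * z - 2))))) :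
    ((ν 𝓕).toReal⁻¹ : ℝ) • ∫ v : ↥(adelicUnipotent ↥(maximalRealSubfield L) L (IsCMField.complexConj L) 3), T v ∂ν =
      ((unfoldingHaarConst L hc hcδ hδ hd ν h𝓕 μE μE₁ μE₂ μF μF₁ μF₂ νv hφ hψ hres : ℝ) : ℂ) *
        (∫ Xi : InfiniteAdeleRing L, ∫ a : InfiniteAdeleRing ↥(maximalRealSubfield L), Ainf Xi a ∂μF₁ ∂μE₁) *
        ((∏ v ∈ S₀, ((Measure.pi fun _ : Fin 3 => νv v) (integralBox ↥(maximalRealSubfield L) (Fin 3) v)).toReal⁻¹ •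
        ∫ p : Fin 3 → v.adicCompletion ↥(maximalRealSubfield L),
          ω v p * (((∏ w' : PlacesOver L v, max 1 (max ((normAbs (w'.1.adicCompletion L) (quadraticLocalEquiv L v (IsCMField.complexConj L) hcδ hδ (p 0, p 1) w') : ℝ≥0) : ℝ)
            ((normAbs (w'.1.adicCompletion L) ((toLocalRing L v (p 2) * algebraMap L (LocalRing L v) δ -
              toLocalRing L v 2⁻¹ * (quadraticLocalEquiv L v (IsCMField.complexConj L) hcδ hδ (p 0, p 1) *
                conjLocal L (IsCMField.complexConj L) v (quadraticLocalEquiv L v (IsCMField.complexConj L) hcδ hδ (p 0, p 1)))) w') : ℝ≥0) : ℝ))) : ℝ) : ℂ) ^ (-z)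
          ∂(Measure.pi fun _ : Fin 3 => νv v)) *
      ((partialStandardL {w : HeightOneSpectrum (𝓞 L) | w.under (𝓞 ↥(maximalRealSubfield L)) ∈ (↑S₀ : Set (HeightOneSpectrum (𝓞 ↥(maximalRealSubfield L))))} (fun w => {φ.valueAtUniformizer w}) (z - 1) *
          partialStandardL (↑S₀ : Set (HeightOneSpectrum (𝓞 ↥(maximalRealSubfield L)))) (fun v => {(ψ * quadraticHeckeCharCM L).valueAtUniformizer v}) (2 * z - 2)) /
        (partialStandardL {w : HeightOneSpectrum (𝓞 L) | w.under (𝓞 ↥(maximalRealSubfield L)) ∈ (↑S₀ : Set (HeightOneSpectrum (𝓞 ↥(maximalRealSubfield L))))} (fun w => {φ.valueAtUniformizer w}) z *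
          partialStandardL (↑S₀ : Set (HeightOneSpectrum (𝓞 ↥(maximalRealSubfield L)))) (fun v => {(ψ * quadraticHeckeCharCM L).valueAtUniformizer v}) (2 * z - 1)))) :=
  (Classical.choose_spec (exists_pos_inv_measure_smul_integral_eq_chiEulerProduct_three L hc hcδ hδ hd ν h𝓕 μE μE₁ μE₂ μF μF₁ μF₂ νv hφ hψ hres)).2
    S₀ hgood hz ω hωc hω1 Ainf Ω hΩ T hT hfac hfin hin hsp

end HaarConst

/-! ## §3 `ε` OF RECORD: the archimedean unit phases `ε_w = (−1)^{eψ_w}`, per place -/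

section ArchPhase

variable [IsCMField L]

/-- **`ε` OF RECORD — `unfoldingArchPhase ξ w := (−1)^{eψ_w}`**: the value at `−1 ∈ U(1)(L_w)` of the archimedean component `u ↦ ι_w(u)^{−eψ_w}` of `ξ.ψ` (★ `OneDimAutRepH.ψ_arch_apply`: `ξ.ψ(ζ, 1) =
∏_w ι_w(ζ_w)^{−eψ_w}`) — the `w`-factor of the archimedean unit constant `ξ.ψ⟨det ι_∞((ι(w₀)·u)_∞)⟩ = ξ.ψ(−1_∞, 1_f)` of the unfolding (`det (Φ₃·u(X, Z)) = −1` at every archimedean place, ★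
`det_weylLong_mul_heis`).  (V) OF RECORD instantiates its binder `ε : InfinitePlace L → ℂ` with `unfoldingArchPhase L ξ`. [cite: Rogawski1990, §12.2 p. 174, §13.9 p. 229] [cite: Patrikis2019, §2.1] -/
def unfoldingArchPhase (ξ : OneDimAutRepH L) (w : InfinitePlace L) : ℂ :=
  (-1 : ℂ) ^ ξ.eψ w

/-- Read-back (`rfl`). [cite: Patrikis2019, §2.1] -/
theorem unfoldingArchPhase_def (ξ : OneDimAutRepH L) (w : InfinitePlace L) : unfoldingArchPhase L ξ w = (-1 : ℂ) ^ ξ.eψ w := rfl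

/-- `ε_w · ε_w = 1` (`(−1)^e·(−1)^e = ((−1)(−1))^e = 1`). [cite: Patrikis2019, §2.1] -/
theorem unfoldingArchPhase_mul_self (ξ : OneDimAutRepH L) (w : InfinitePlace L) : unfoldingArchPhase L ξ w * unfoldingArchPhase L ξ w = 1 := by
  rw [unfoldingArchPhase_def, ← mul_zpow, neg_one_mul, neg_neg, one_zpow]

/-- **`‖ε_w‖ = 1`**. [cite: Patrikis2019, §2.1] -/
theorem norm_unfoldingArchPhase (ξ : OneDimAutRepH L) (w : InfinitePlace L) : ‖unfoldingArchPhase L ξ w‖ = 1 := by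
  rw [unfoldingArchPhase_def, norm_zpow, norm_neg, norm_one, one_zpow]

/-- **(V)'s letter `hε1`: `∀ w, ‖ε w‖ ≤ 1`** at `ε := unfoldingArchPhase L ξ`. [cite: Patrikis2019, §2.1] [cite: MoeglinWaldspurger1995, IV.1.11] -/
theorem unfoldingArchPhase_norm_le_one (ξ : OneDimAutRepH L) : ∀ w : InfinitePlace L, ‖unfoldingArchPhase L ξ w‖ ≤ 1 :=
  fun w => (norm_unfoldingArchPhase L ξ w).le

/-- **(V)'s letter `hε0`: `∀ w, ε w ≠ 0`** at `ε := unfoldingArchPhase L ξ`. [cite: Patrikis2019, §2.1] [cite: MoeglinWaldspurger1995, IV.1.11] -/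
theorem unfoldingArchPhase_ne_zero (ξ : OneDimAutRepH L) : ∀ w : InfinitePlace L, unfoldingArchPhase L ξ w ≠ 0 :=
  fun w h => by simpa [h] using norm_unfoldingArchPhase L ξ w

/-- `ε_w = (−1)^{−eψ_w}` as well (the exponent sign is immaterial for the base `−1`) — the currency of ★ `ψ_arch_apply`. [cite: Patrikis2019, §2.1] -/
theorem unfoldingArchPhase_eq_zpow_neg (ξ : OneDimAutRepH L) (w : InfinitePlace L) : unfoldingArchPhase L ξ w = (-1 : ℂ) ^ (-ξ.eψ w) := by
  rw [zpow_neg, unfoldingArchPhase_def]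
  exact (inv_eq_of_mul_eq_one_right (unfoldingArchPhase_mul_self L ξ w)).symm

/-- `c • (−1) = −1` on the archimedean ideles (`c` acts by ring automorphisms). [folklore] -/
theorem smul_neg_one_infiniteUnits : (IsCMField.complexConj L • (-1 : (InfiniteAdeleRing L)ˣ)) = -1 := by
  apply Units.ext
  rw [ArchHerbrand.val_smul_units, Units.val_neg, Units.val_one, smul_neg, smul_one]

/-- **`(−1_∞, 1_f)` lies in the torus `T(𝔸_{L⁺}) = U(1)_{L∕L⁺}(𝔸_{L⁺})`** (`(−1)·c(−1) = (−1)(−1) = 1`). [cite: Rogawski1990, §12.2 p. 174] -/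
theorem infiniteIdeles_neg_one_mem_torus : infiniteIdeles L (-1) ∈ TorusDict.torus (IsCMField.complexConj L) := by
  rw [TorusDict.mem_torus_iff, TorusDict.smul_infiniteIdeles, smul_neg_one_infiniteUnits, ← map_mul, neg_one_mul, neg_neg, map_one]

/-- **THE TORUS VALUE OF RECORD**: `ξ.ψ(−1_∞, 1_f) = ∏_w unfoldingArchPhase ξ w = ∏_w (−1)^{eψ_w}` — for ANY presentation `h` of the membership (★ `OneDimAutRepH.ψ_arch_apply` at `ζ = −1`,
`ι_w(−1) = −1`). [cite: Rogawski1990, §12.2 p. 174] [cite: Patrikis2019, §2.1] -/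
theorem ψ_neg_one_arch_eq_prod_unfoldingArchPhase (ξ : OneDimAutRepH L) (h : infiniteIdeles L (-1) ∈ TorusDict.torus (IsCMField.complexConj L)) :
    ((ξ.ψ ⟨infiniteIdeles L (-1), h⟩ : ℂˣ) : ℂ) = ∏ w : InfinitePlace L, unfoldingArchPhase L ξ w := by
  rw [OneDimAutRepH.ψ_arch_apply ξ (-1) h]
  refine Finset.prod_congr rfl fun w _ => ?_
  rw [unfoldingArchPhase_eq_zpow_neg, show ((-1 : (InfiniteAdeleRing L)ˣ) : InfiniteAdeleRing L) w = -1 from rfl, map_neg, map_one]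

/-- The same at ANY torus element whose underlying idele is `(−1_∞, 1_f)` (the shape in which ★ `adelicOneEquivTorus (adelicDet …)` presents `ξ.ψ⟨det ι_∞ a⟩`). [cite: Rogawski1990, §13.9 p. 229] -/
theorem ψ_eq_prod_unfoldingArchPhase_of_coe_eq (ξ : OneDimAutRepH L) (t : ↥(TorusDict.torus (IsCMField.complexConj L)))
    (ht : (t : ideleGroup L) = infiniteIdeles L (-1)) :
    ((ξ.ψ t : ℂˣ) : ℂ) = ∏ w : InfinitePlace L, unfoldingArchPhase L ξ w := by
  have e : t = ⟨infiniteIdeles L (-1), infiniteIdeles_neg_one_mem_torus L⟩ := Subtype.ext ht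
  rw [e]
  exact ψ_neg_one_arch_eq_prod_unfoldingArchPhase L ξ _

end ArchPhase

/-! ## §4 The `(−1)^{m_w}` of ★ p13's big-cell law cancels: `(−1)^m · conj (archUnitaryValue m 0 (1 − conj Z)) = archUnitaryValue m 0 (Z − 1)` -/

section Cancel

/-- **NO `m_w`-DEPENDENT SIGN SURVIVES**: `(−1)^m · conj (archUnitaryValue m 0 (1 − conj Z)) = archUnitaryValue m 0 (Z − 1)` for every `m : ℤ`, `Z : ℂ` (`Z − 1 = −conj (1 − conj Z)` ★ `sub_one_eq_neg_conj`,
★ `archUnitaryValue_neg_conj` at `t = 0`). [cite: Patrikis2019, §2.1] [cite: MoeglinWaldspurger1995, IV.1.11] -/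
theorem neg_one_zpow_mul_conj_archUnitaryValue (m : ℤ) (Z : ℂ) : (-1 : ℂ) ^ m * conj (archUnitaryValue m 0 (1 - conj Z)) = archUnitaryValue m 0 (Z - 1) := by
  rw [sub_one_eq_neg_conj Z, archUnitaryValue_neg_conj, neg_zero]

/-- Product form over the archimedean places. [cite: MoeglinWaldspurger1995, IV.1.11] -/
theorem prod_neg_one_zpow_mul_conj_archUnitaryValue (m : InfinitePlace L → ℤ) (Z : InfinitePlace L → ℂ) :
    (∏ w : InfinitePlace L, (-1 : ℂ) ^ m w * conj (archUnitaryValue (m w) 0 (1 - conj (Z w)))) = ∏ w : InfinitePlace L, archUnitaryValue (m w) 0 (Z w - 1) :=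
  Finset.prod_congr rfl fun w _ => neg_one_zpow_mul_conj_archUnitaryValue (m w) (Z w)

end Cancel

end Summit.HodgeConjecture.HodgeConjecture.Cruxes.H413.K2E1ChiUnfoldingConstantsOfRecordU3

end
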